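import Mathlib
import Literature.MathematicalPhysics.QuantumFieldTheory.Balaban1983to89.T4EtaRateCoeffDefect
import Literature.MathematicalPhysics.QuantumFieldTheory.Balaban1983to89.B11SupSize190
import Summits.QuantumFields.YangMills.Theorems.BalabanUVNodesN15MatrixSpecies
import HarnessLib

/-!
# Route «BalabanUVNodes» (cluster K4 «SpineRates»), Track-A DAG node N15 = spine estimate NE2, BACKGROUND LAYER — FIRST MISSING
# ESTIMATE, part 13c: THE MATRIX-COEFFICIENT MULTIPLICATION OPERATOR IN THE LINEAGE — `(M_C λ)(x) = C(x)·λ(x)` for an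
# operator-valued coefficient `C : X → (E →L[ℝ] E)` on `E`-valued lattice fields (`E = 𝔤`), its EXACT η-defect `𝔇(M_{C′}, M_C) = M_{C′ − C∘π}∘τ`,
# the diagonal block majorant w.r.t. the sup size `B11SupSize190.supSize` from the operator-norm fit `‖C′(x′) − C(πx′)‖ ≤ o`, the
# transfer ∕ sandwich forms (`T4EtaRateDefect` BY NAME), the print's transporter coefficient `η⁻¹(exp(η ad_{A(b)}) − 1)` END TO END, and the
# vector block average (the linearised transport of a `𝔤`-valued background)

Cell `pub-ymgap`, seat `pub-ymgap-dag-n15-b` (generation g3; FIRST-MISSING-ESTIMATE, HUMAN RULING D-0062; chair R424 venue; ROSTER-D0062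
l.26).  `bears_on: R4∕N15`.  Filed `--supports stmt-QuantumFields-19351`.  Third of three parts of residue (i) of `HOME/HANDOFF-dag-n15-b.md`
§g2.3 («the MATRIX species … needs a matrix-coefficient `mulOp` in the lineage first»): 13a `BalabanUVNodesN15ExpLetters` (exp∕ad letters), 13b
`BalabanUVNodesN15MatrixSpecies` (the species `Phi1`∕`Phi2`, letters, fits).  This file generalises the SCALAR coefficient-defect calculus of
`T4EtaRateCoeffDefect` §1–§2∕§6 (`mulOp`, `idef_mulOp_eq`, `hasMaj_idef_mulOp`, `hasMaj_idef_mulOp_comp_transfer`) and of g0 file 4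
`BalabanUVNodesN15FirstOrderDefect.hasMaj_comp_idef_zerothOrder_comp` to OPERATOR-VALUED coefficients acting on VECTOR-VALUED fields, with
`B11SectG.BlockNorm.ofBlocks` (sup of `|·|` over a block) replaced by `B11SupSize190.supSize` (sup of `‖·‖` over a box).

WHY.  The coefficients of [Balaban1985BackgroundPropagators] (3.50)–(3.52) p. 400 — *«exp(iη ad_{A′(b)})»*, *«F′_{1,k}(i ad_{A′(b)})»*, the
transporter `η⁻¹(exp(iη ad_{A′(b)}) − 1)` of the covariant derivative — are OPERATORS on `𝔤` multiplying `𝔤`-valued fields `λ` pointwise; the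
record `t4/T4-EST-U1a.md` §3 STEP 2 (NE2-LOCAL-A): *«multiplication operators built from A … their pull-back discrepancy is ≤ (η-scale variation
of A′) … RELATIVE size (η∕L^jη)·O(1)»*.  The scalar lineage (g0 files 1–11, g2 12a–12e) models them by real multiplication operators; here the
same two facts — the η-defect of a multiplication operator IS multiplication by the fit error, and its block majorant is DIAGONAL of size the
blockwise sup of the fit error — are proved for operator-valued coefficients, so that 13b's operator-norm fits (`fit_Phi1_ad`, `fit_Phi2_ad`)
ARE the `hfit` binder.  THE PRINT USED (SHAPES only): (3.35) p. 396, (3.50)–(3.52) p. 400; [B6] (2.54) p. 233 for the transfer form.  Nothing of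
[B9] asserted.

CONTENTS (all [folklore]: linear algebra and finite sups over hypothesis-shaped data).
* §1 `pullV π` (pull-back of `E`-valued fields), `emulOp C` (`(M_C λ)(x) = C(x)(λ x)`); `idef_emulOp_apply` ∕ `idef_emulOp_eq` (EXACT:
  `𝔇(M_{C′}, M_C) = M_{C′ − C∘π} ∘ pullV π`), `idef_emulOp_pull_self` (no defect for `C′ = C∘π`).
* §2 THE BLOCK MAJORANT between sup sizes `supSize g box blk` (boxes compatible with the blocks: `hbox : x ∈ box (blk x)`, and the fine box of
  `y` lies over the coarse block `y`): `loc_fine_emul_pull_le` (the one estimate), `hasMaj_idef_emulOp` (diagonal majorant `diagK o` from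
  `‖C′(x′) − C(πx′)‖ ≤ o(blk(πx′))`), `hasMaj_pullV` (`diagK 1`), `hasMaj_emulOp` (`diagK m` from `‖C(x)‖ ≤ m(blk x)`), `hasMaj_idef_emulOp_decay`
  (source-weighted decay form `ε·e^{−ρd}·w(y′)` under `o ≤ εw`), `sharp_hbox` ∕ `sharp_hbox'` (the sharp boxes `{x : blk x = y}` qualify).
* §3 IN THE LINEAGE (T4EtaRateDefect BY NAME): `hasMaj_idef_emulOp_comp_transfer` (`𝔇(M_{C′},M_C)·T ≤ εA₀C·e^{−ρd}·w(y′)` for a coarse factor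
  `T ≤ A₀e^{−(ρ+σ)d}`, slow weight — `hasMaj_comp_transfer`), `hasMaj_comp_idef_emulOp_comp` (SANDWICHED `T′∘𝔇(M_{C′},M_C)∘A ≤
  m_T(ε A₀C)e^{−ρd}w(y′)` — file 4's `hasMaj_comp_idef_zerothOrder_comp` for matrix coefficients, `hasMaj_comp_wrow_source`).
* §4 END TO END with 13b: `hasMaj_idef_transporter` — fine coefficient `Phi1(η′, ad_{A′(x′)})`, coarse `Phi1(η, ad_{Ā(πx′)})` for `𝔄`-valued
  backgrounds `‖A′‖, ‖Ā‖ ≤ r` (regime `η₀(2r) ≤ 1`) with the blockwise field fit `‖A′(x′) − Ā(πx′)‖ ≤ o(blk(πx′))` ⟹ diagonal majorant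
  `diagK (2e·o + 2e(2r)²η)`; `hasMaj_idef_secondOrderCoeff` (the same for `F′_{1,k}`); `transporter_rate` (the rate inserted: `θ₁ = η′G₁`, `Mη′ = η`).
* §5 THE LINEARISED TRANSPORT OF A VECTOR-VALUED BACKGROUND: `blockAvgV π A′` (fibrewise mean in `E`), `fit_blockAvgV` (`‖A′(x′) − blockAvgV A′(πx′)‖ ≤ Ω(πx′)`
  from a vector oscillation letter `‖A′(x₁′) − A′(x₂′)‖ ≤ Ω` on fibres — `T4EtaRateCoeffDefect.fit_blockAvg` for normed spaces),
  `norm_blockAvgV_le` (the coarse field stays in the box `‖·‖ ≤ r`).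

HONEST FRAMING ∕ LIMITS.  MECHANISM over hypothesis-SHAPED letters: spaces, block maps, boxes, coefficients, backgrounds are data; the
oscillation letter `Ω` of §5 is (3.35)-SHAPED (on `ℤ^d` it is `d(M−1)θ₁` by 12a's `T4EtaRateCoeffDefect.osc_of_inBlockBondBound` componentwise —
not restated here); zero-range∕diagonal kernels only (coefficient defects have no decay to prove); linearised transport (Bałaban's nonlinear
(C3) average = NE3's currency, not here).  NE2⁺ NOT PRINTED, NOT proved; count-neutral (typed 28∕28; nothing discharged); one finite T⁴ at fixed
ε — NOT infinite volume, NOT OS on ℝ⁴, NOT a mass gap, NOT Clay.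
-/

noncomputable section

namespace Summit.QuantumFields.YangMills.BalabanUVNodes.N15.MatrixSpecies

open Literature.MathematicalPhysics.QuantumFieldTheory.Balaban1983to89
open Literature.MathematicalPhysics.QuantumFieldTheory.Balaban1983to89.T4EtaRateDefect (idef idef_apply SlowWeight hasMaj_comp_transfer
  hasMaj_comp_wrow_source)
open Literature.MathematicalPhysics.QuantumFieldTheory.Balaban1983to89.T4EtaRateCoeffDefect (diagK diagK_same diagK_ne diagK_nonneg
  diagK_le_decay wrow_diagK fibre mem_fibre)
open Literature.MathematicalPhysics.QuantumFieldTheory.Balaban1983to89.Beta.AveragingCorrectionJets (adCLM)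
open B6RandomWalk B11SectG B11SupSize190 B9SectDWeightedNeumann Finset

/-! ## §1 Pull-back and matrix-coefficient multiplication operators on vector-valued lattice fields; the exact defect -/

section Algebra

variable {X X' : Type} {E : Type} [NormedAddCommGroup E] [NormedSpace ℝ E]

/-- The piecewise-constant PULL-BACK of `E`-valued fields along `π : X′ → X`: `(pullV π f)(x′) = f(π x′)` (`T4EtaRateCoeffDefect.pull` for
vector values; Mathlib `LinearMap.funLeft`). [folklore] -/
def pullV (π : X' → X) : (X → E) →ₗ[ℝ] (X' → E) := LinearMap.funLeft ℝ E π

/-- Pointwise form of the pull-back. [folklore] -/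
@[simp] theorem pullV_apply (π : X' → X) (f : X → E) (x' : X') : pullV π f x' = f (π x') := rfl

/-- THE MATRIX-COEFFICIENT MULTIPLICATION OPERATOR `(M_C λ)(x) = C(x)·λ(x)` by an operator-valued coefficient `C : X → (E →L[ℝ] E)` — the
shape in which a `𝔤`-valued background enters the local operators of [B9] (3.50)–(3.53) (`C(b) = Φ(η, ad_{A(b)})`), as MECHANISM
(`B6Prop26Gluing.mulOp` for vector values). [folklore] -/
def emulOp (C : X → (E →L[ℝ] E)) : (X → E) →ₗ[ℝ] (X → E) where
  toFun f x := C x (f x)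
  map_add' f f' := funext fun x => by simp
  map_smul' c f := funext fun x => by simp

/-- Pointwise form: `(M_C f)(x) = C(x)(f x)`. [folklore] -/
@[simp] theorem emulOp_apply (C : X → (E →L[ℝ] E)) (f : X → E) (x : X) : emulOp C f x = C x (f x) := rfl

/-- THE EXACT DEFECT FORMULA, pointwise: `(M_{C′}τ − τM_C) f (x′) = (C′(x′) − C(πx′))·f(πx′)` — the η-defect of a matrix coefficient is
multiplication by the FIT ERROR `C′ − C∘π`. [folklore] -/
theorem idef_emulOp_apply (π : X' → X) (C' : X' → (E →L[ℝ] E)) (C : X → (E →L[ℝ] E)) (f : X → E) (x' : X') :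
    idef (pullV π) (pullV π) (emulOp C') (emulOp C) f x' = (C' x' - C (π x')) (f (π x')) := by
  simp only [idef_apply, Pi.sub_apply, emulOp_apply, pullV_apply, _root_.sub_apply]

/-- THE EXACT DEFECT FORMULA, as operators: `𝔇(M_{C′}, M_C) = M_{C′ − C∘π} ∘ τ`. [folklore] -/
theorem idef_emulOp_eq (π : X' → X) (C' : X' → (E →L[ℝ] E)) (C : X → (E →L[ℝ] E)) :
    idef (pullV π) (pullV π) (emulOp C') (emulOp C) = emulOp (fun x' => C' x' - C (π x')) ∘ₗ pullV π := by
  refine LinearMap.ext fun f => funext fun x' => ?_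
  rw [idef_emulOp_apply]
  rfl

/-- No defect when the fine coefficient IS the pull-back of the coarse one. [folklore] -/
theorem idef_emulOp_pull_self (π : X' → X) (C : X → (E →L[ℝ] E)) :
    idef (pullV π) (pullV π) (emulOp (C ∘ π)) (emulOp C) = 0 := by
  refine LinearMap.ext fun f => funext fun x' => ?_
  rw [idef_emulOp_apply]
  simp

end Algebra

/-! ## §2 The block majorant of a matrix-coefficient defect between sup sizes: diagonal, = the blockwise sup of the fit error -/

section Majorant

variable {X X' : Type} {E : Type} [NormedAddCommGroup E] [NormedSpace ℝ E] {g : B6.Geometry}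

/-- THE ONE ESTIMATE.  A fine field `x′ ↦ c(x′)(μ(πx′))` with `‖c(x′)‖ ≤ o(blk(πx′))` has, on the box of `y`, fine sup `≤ o(y)·`(coarse sup of `μ` on
the box of `y`) — and `0` on every box other than the one over the block where the (localised) coarse input `μ` lives.  Box conventions:
every coarse point lies in the box of its block (`hbox`), and the fine box of `y` lies over the coarse block `y` (`hbox'`). [folklore] -/
theorem loc_fine_emul_pull_le {box : g.Site → Finset X} {blk : X → g.Site} {box' : g.Site → Finset X'} {blk' : X' → g.Site} (π : X' → X)
    (hbox : ∀ x, x ∈ box (blk x)) (hbox' : ∀ y, ∀ x' ∈ box' y, blk (π x') = y)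
    {c : X' → (E →L[ℝ] E)} {o : g.Site → ℝ} (ho : ∀ y, 0 ≤ o y) (hc : ∀ x', ‖c x'‖ ≤ o (blk (π x')))
    {y' : g.Site} {μ : X → E} (hμ : (supSize g box blk : BlockNorm g (X → E)).IsLoc y' μ) (y : g.Site) :
    (supSize g box' blk' : BlockNorm g (X' → E)).loc y (fun x' => c x' (μ (π x'))) ≤
      diagK o y y' * (supSize g box blk : BlockNorm g (X → E)).loc y' μ := by
  classical
  have hμ' : ∀ x : X, blk x ≠ y' → μ x = 0 := (supSize_isLoc_iff y' μ).1 hμ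
  have hℓ0 := (supSize g box blk : BlockNorm g (X → E)).loc_nonneg y' μ
  by_cases hy : y = y'
  · subst hy
    rw [diagK_same]
    refine loc_le_of_forall (mul_nonneg (ho y) hℓ0) fun x' hx' => ?_
    have hx : blk (π x') = y := hbox' y x' hx'
    calc ‖c x' (μ (π x'))‖ ≤ ‖c x'‖ * ‖μ (π x')‖ := (c x').le_opNorm _
      _ ≤ o y * (supSize g box blk : BlockNorm g (X → E)).loc y μ :=
          mul_le_mul (hx ▸ hc x') (hx ▸ norm_apply_le_loc (hbox (π x')) μ) (norm_nonneg _) (ho y)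
  · rw [diagK_ne o hy, zero_mul]
    refine loc_le_of_forall le_rfl fun x' hx' => ?_
    have hx : blk (π x') = y := hbox' y x' hx'
    have h0 : μ (π x') = 0 := hμ' (π x') (by rw [hx]; exact hy)
    simp [h0]

/-- THE BLOCK MAJORANT OF A MATRIX-COEFFICIENT DEFECT.  From the OPERATOR-NORM FIT HYPOTHESIS `‖C′(x′) − C(πx′)‖ ≤ o(blk(πx′))` (`o ≥ 0`):
`𝔇(M_{C′}, M_C)` has the diagonal majorant `1_{y=y′}·o(y′)` between the sup sizes of the coarse and the fine lattice. [folklore] -/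
theorem hasMaj_idef_emulOp {box : g.Site → Finset X} {blk : X → g.Site} {box' : g.Site → Finset X'} {blk' : X' → g.Site}
    (π : X' → X) (hbox : ∀ x, x ∈ box (blk x)) (hbox' : ∀ y, ∀ x' ∈ box' y, blk (π x') = y)
    {C' : X' → (E →L[ℝ] E)} {C : X → (E →L[ℝ] E)} {o : g.Site → ℝ}
    (ho : ∀ y, 0 ≤ o y) (hfit : ∀ x', ‖C' x' - C (π x')‖ ≤ o (blk (π x'))) :
    HasMaj (supSize g box blk : BlockNorm g (X → E)) (supSize g box' blk' : BlockNorm g (X' → E))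
      (idef (pullV π) (pullV π) (emulOp C') (emulOp C)) (diagK o) := by
  intro y' μ hμ y
  have hfun : idef (pullV π) (pullV π) (emulOp C') (emulOp C) μ = fun x' => (C' x' - C (π x')) (μ (π x')) :=
    funext fun x' => idef_emulOp_apply π C' C μ x'
  rw [hfun]
  exact loc_fine_emul_pull_le π hbox hbox' ho hfit hμ y

/-- The pull-back itself is a contraction between the sup sizes, box by box (`diagK 1`). [folklore] -/
theorem hasMaj_pullV {box : g.Site → Finset X} {blk : X → g.Site} {box' : g.Site → Finset X'} {blk' : X' → g.Site}
    (π : X' → X) (hbox : ∀ x, x ∈ box (blk x)) (hbox' : ∀ y, ∀ x' ∈ box' y, blk (π x') = y) :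
    HasMaj (supSize g box blk : BlockNorm g (X → E)) (supSize g box' blk' : BlockNorm g (X' → E)) (pullV π) (diagK fun _ => 1) := by
  intro y' μ hμ y
  have hfun : pullV π μ = fun x' => (1 : E →L[ℝ] E) (μ (π x')) := funext fun x' => by simp
  rw [hfun]
  exact loc_fine_emul_pull_le π hbox hbox' (fun _ => zero_le_one) (fun _ => ContinuousLinearMap.norm_id_le) hμ y

/-- A matrix-coefficient multiplication operator with `‖C(x)‖ ≤ m(blk x)` (`m ≥ 0`) has the diagonal majorant `diagK m` on the sup size of
boxes compatible with the blocks. [folklore] -/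
theorem hasMaj_emulOp {box : g.Site → Finset X} {blk : X → g.Site} (hbox : ∀ x, x ∈ box (blk x))
    (hboxb : ∀ y, ∀ x ∈ box y, blk x = y) {C : X → (E →L[ℝ] E)} {m : g.Site → ℝ} (hm : ∀ y, 0 ≤ m y)
    (hC : ∀ x, ‖C x‖ ≤ m (blk x)) :
    HasMaj (supSize g box blk : BlockNorm g (X → E)) (supSize g box blk : BlockNorm g (X → E)) (emulOp C) (diagK m) := by
  intro y' μ hμ y
  exact loc_fine_emul_pull_le (blk' := blk) id hbox hboxb hm hC hμ y

/-- SOURCE-WEIGHTED DECAY FORM: if the blockwise fit error is dominated by a site weight, `o ≤ ε·w`, then `𝔇(M_{C′}, M_C)` has the majorant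
`ε·e^{−ρd(y,y′)}·w(y′)` at EVERY rate `ρ` (`d(y,y) = 0`; `T4EtaRateCoeffDefect.diagK_le_decay`). [folklore] -/
theorem hasMaj_idef_emulOp_decay {box : g.Site → Finset X} {blk : X → g.Site} {box' : g.Site → Finset X'} {blk' : X' → g.Site}
    (π : X' → X) (hbox : ∀ x, x ∈ box (blk x)) (hbox' : ∀ y, ∀ x' ∈ box' y, blk (π x') = y)
    {C' : X' → (E →L[ℝ] E)} {C : X → (E →L[ℝ] E)} {o w : g.Site → ℝ} {ε : ℝ} (ρ : ℝ)
    (ho : ∀ y, 0 ≤ o y) (how : ∀ y, o y ≤ ε * w y) (hdiag : ∀ y, g.dist y y = 0)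
    (hfit : ∀ x', ‖C' x' - C (π x')‖ ≤ o (blk (π x'))) :
    HasMaj (supSize g box blk : BlockNorm g (X → E)) (supSize g box' blk' : BlockNorm g (X' → E))
      (idef (pullV π) (pullV π) (emulOp C') (emulOp C)) (fun y y' => ε * Real.exp (-(ρ * g.dist y y')) * w y') :=
  (hasMaj_idef_emulOp π hbox hbox' ho hfit).mono (diagK_le_decay ρ ho how hdiag)

variable [DecidableEq g.Site]

/-- The SHARP boxes `fibre blk y = {x : blk x = y}` satisfy the first convention: every point lies in the box of its block. [folklore] -/
theorem sharp_hbox [Fintype X] (blk : X → g.Site) : ∀ x, x ∈ fibre blk (blk x) := fun x => (mem_fibre blk (blk x) x).2 rfl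

/-- The SHARP boxes of the composite block map `blk ∘ π` satisfy the second convention: the fine box of `y` lies over the coarse block `y`.
[folklore] -/
theorem sharp_hbox' [Fintype X'] (blk : X → g.Site) (π : X' → X) : ∀ y, ∀ x' ∈ fibre (blk ∘ π) y, blk (π x') = y :=
  fun y x' hx' => (mem_fibre (blk ∘ π) y x').1 hx'

end Majorant

/-! ## §3 In the lineage: the transfer form and the sandwiched form (`T4EtaRateDefect` BY NAME) -/

section Lineage

variable {X X' : Type} {E : Type} [NormedAddCommGroup E] [NormedSpace ℝ E] {g : B6.Geometry}
  {box : g.Site → Finset X} {blk : X → g.Site} {box' : g.Site → Finset X'} {blk' : X' → g.Site}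
  {F₁ F₃ : Type} [AddCommGroup F₁] [Module ℝ F₁] [AddCommGroup F₃] [Module ℝ F₃] {b₁ : BlockNorm g F₁} {b₃ : BlockNorm g F₃}

/-- THE MATRIX-COEFFICIENT DEFECT INSIDE A COMPOSITE (`T4EtaRateDefect.hasMaj_comp_transfer` BY NAME; `T4EtaRateCoeffDefect.hasMaj_idef_mulOp_comp_transfer`
for matrix coefficients): if the blockwise fit error is dominated by a slow site weight, `o ≤ ε·w` (`w ≥ 0` of tilt `σ` and constant `C`), then
`𝔇(M_{C′}, M_C)·T`, for any coarse factor `T` of majorant `A₀e^{−(ρ+σ)d}`, has the SOURCE-WEIGHTED majorant `εA₀C·e^{−ρd(y,y′)}·w(y′)`. [folklore] -/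
theorem hasMaj_idef_emulOp_comp_transfer (π : X' → X) (hbox : ∀ x, x ∈ box (blk x)) (hbox' : ∀ y, ∀ x' ∈ box' y, blk (π x') = y)
    {C' : X' → (E →L[ℝ] E)} {Cc : X → (E →L[ℝ] E)} {o w : g.Site → ℝ} {ε ρ σ C A₀ : ℝ} {T : F₁ →ₗ[ℝ] (X → E)}
    (htri : Triangle254 g) (hdiag : ∀ y, g.dist y y = 0) (hρ : 0 ≤ ρ) (hA₀ : 0 ≤ A₀) (hC : 0 ≤ C)
    (hε : 0 ≤ ε) (hw : ∀ y, 0 ≤ w y) (hsw : SlowWeight g σ C w)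
    (ho : ∀ y, 0 ≤ o y) (how : ∀ y, o y ≤ ε * w y) (hfit : ∀ x', ‖C' x' - Cc (π x')‖ ≤ o (blk (π x')))
    (hT : HasMaj b₁ (supSize g box blk : BlockNorm g (X → E)) T (fun y y' => A₀ * Real.exp (-((ρ + σ) * g.dist y y')))) :
    HasMaj b₁ (supSize g box' blk' : BlockNorm g (X' → E)) (idef (pullV π) (pullV π) (emulOp C') (emulOp Cc) ∘ₗ T)
      (fun y y' => ε * A₀ * C * Real.exp (-(ρ * g.dist y y')) * w y') := by
  classical
  have h₁ : HasMaj (supSize g box blk : BlockNorm g (X → E)) (supSize g box' blk' : BlockNorm g (X' → E))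
      (idef (pullV π) (pullV π) (emulOp C') (emulOp Cc)) (fun y y'' => diagK (fun _ : g.Site => ε) y y'' * w y'') := by
    refine (hasMaj_idef_emulOp π hbox hbox' ho hfit).mono fun y y'' => ?_
    by_cases hy : y = y''
    · subst hy
      simpa using how y
    · rw [diagK_ne o hy, diagK_ne _ hy, zero_mul]
  have key := hasMaj_comp_transfer htri hρ hA₀ hC (diagK_nonneg fun _ => hε) hw hsw (wrow_diagK ρ ε hdiag) h₁ hT
  have hκ : (supSize g box blk : BlockNorm g (X → E)).κ = 1 := rfl
  simpa only [hκ, one_mul] using key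

/-- THE MATRIX COEFFICIENT SANDWICHED (g0 file 4's `hasMaj_comp_idef_zerothOrder_comp` for matrix coefficients): `T′ ∘ 𝔇(M_{C′}, M_C) ∘ A ≤
m_T·(ε₀A₀C)·e^{−ρd}·w(y′)` from the fit `‖C′ − C∘π‖ ≤ o₀ ≤ ε₀·w`, `T′ ≤ N_T` (`‖N_T‖_ρ ≤ m_T`) and `A ≤ A₀e^{−(ρ+σ)d}`
(`hasMaj_idef_emulOp_comp_transfer` + `T4EtaRateDefect.hasMaj_comp_wrow_source`). [folklore] -/
theorem hasMaj_comp_idef_emulOp_comp (π : X' → X) (hbox : ∀ x, x ∈ box (blk x)) (hbox' : ∀ y, ∀ x' ∈ box' y, blk (π x') = y)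
    (htri : Triangle254 g) (hdiag : ∀ y, g.dist y y = 0) {ρ σ C ε₀ A₀ m_T : ℝ}
    (hρ : 0 ≤ ρ) (hA₀ : 0 ≤ A₀) (hC : 0 ≤ C) (hε₀ : 0 ≤ ε₀) {w o₀ : g.Site → ℝ} (hw : ∀ y, 0 ≤ w y)
    (hsw : SlowWeight g σ C w) (ho₀ : ∀ y, 0 ≤ o₀ y) (how₀ : ∀ y, o₀ y ≤ ε₀ * w y)
    {C' : X' → (E →L[ℝ] E)} {Cc : X → (E →L[ℝ] E)} (hfit : ∀ x', ‖C' x' - Cc (π x')‖ ≤ o₀ (blk (π x')))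
    {T' : (X' → E) →ₗ[ℝ] F₃} {A : F₁ →ₗ[ℝ] (X → E)} {N_T : g.Site → g.Site → ℝ} (hNT : ∀ a b, 0 ≤ N_T a b)
    (hmT : WRow g ρ N_T m_T) (hT : HasMaj (supSize g box' blk' : BlockNorm g (X' → E)) b₃ T' N_T)
    (hA : HasMaj b₁ (supSize g box blk : BlockNorm g (X → E)) A (fun y y' => A₀ * Real.exp (-((ρ + σ) * g.dist y y')))) :
    HasMaj b₁ b₃ (T' ∘ₗ idef (pullV π) (pullV π) (emulOp C') (emulOp Cc) ∘ₗ A)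
      (fun y y' => m_T * (ε₀ * A₀ * C) * Real.exp (-(ρ * g.dist y y')) * w y') := by
  have hin := hasMaj_idef_emulOp_comp_transfer (b₁ := b₁) (box' := box') (blk' := blk') π hbox hbox' htri hdiag hρ hA₀ hC hε₀ hw
    hsw ho₀ how₀ hfit hA
  have key := hasMaj_comp_wrow_source htri hρ (mul_nonneg (mul_nonneg hε₀ hA₀) hC) hNT hw hmT hT hin
  have hκ' : (supSize g box' blk' : BlockNorm g (X' → E)).κ = 1 := rfl
  have hop : T' ∘ₗ idef (pullV π) (pullV π) (emulOp C') (emulOp Cc) ∘ₗ A =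
      T' ∘ₗ (idef (pullV π) (pullV π) (emulOp C') (emulOp Cc) ∘ₗ A) := rfl
  rw [hop]
  simpa only [hκ', one_mul] using key

end Lineage

/-! ## §4 End to end with 13b: the print's coefficients `Φ(η, ad_{A(b)})` on `𝔄`-valued fields -/

section EndToEnd

variable {X X' : Type} {𝔄 : Type} [NormedRing 𝔄] [NormedAlgebra ℝ 𝔄] [CompleteSpace 𝔄] {g : B6.Geometry}
  {box : g.Site → Finset X} {blk : X → g.Site} {box' : g.Site → Finset X'} {blk' : X' → g.Site}

/-- THE PRINT's TRANSPORTER COEFFICIENT `η⁻¹(exp(η ad_{A(b)}) − 1)` IN THE LINEAGE: for `𝔄`-valued backgrounds `‖A′‖, ‖Ā‖ ≤ r` in the regime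
`η₀·(2r) ≤ 1`, spacings `0 ≤ η′ ≤ η ≤ η₀`, and the BLOCKWISE field fit `‖A′(x′) − Ā(πx′)‖ ≤ o(blk(πx′))` (`o ≥ 0`), the η-defect of the
matrix-coefficient multiplication operators `M_{Phi1(η′, ad A′)}` (fine) vs `M_{Phi1(η, ad Ā)}` (coarse) on `𝔄`-valued fields has the DIAGONAL block
majorant `diagK (2e·o + 2e(2r)²η)` between the sup sizes (13b `fit_Phi1_ad` + §2 `hasMaj_idef_emulOp`). [folklore] -/
theorem hasMaj_idef_transporter (π : X' → X) (hbox : ∀ x, x ∈ box (blk x)) (hbox' : ∀ y, ∀ x' ∈ box' y, blk (π x') = y)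
    {η₀ r η η' : ℝ} (hreg : η₀ * (2 * r) ≤ 1) (hη' : 0 ≤ η') (hη'η : η' ≤ η) (hη : η ≤ η₀)
    {a' : X' → 𝔄} {a : X → 𝔄} (ha' : ∀ x', ‖a' x'‖ ≤ r) (ha : ∀ x, ‖a x‖ ≤ r)
    {o : g.Site → ℝ} (ho : ∀ y, 0 ≤ o y) (hfit : ∀ x', ‖a' x' - a (π x')‖ ≤ o (blk (π x'))) :
    HasMaj (supSize g box blk : BlockNorm g (X → 𝔄)) (supSize g box' blk' : BlockNorm g (X' → 𝔄))
      (idef (pullV π) (pullV π) (emulOp fun x' => Phi1 η' (adCLM ℝ (a' x'))) (emulOp fun x => Phi1 η (adCLM ℝ (a x))))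
      (diagK fun y => (2 * Real.exp 1) * o y + 2 * (Real.exp 1 * (2 * r) ^ 2) * η) := by
  refine hasMaj_idef_emulOp π hbox hbox' (fun y => ?_) fun x' => ?_
  · have : 0 ≤ η := hη'.trans hη'η
    have := ho y
    positivity
  · exact fit_Phi1_ad π hreg hη' hη'η hη ha' ha (o := fun x => o (blk x)) hfit x'

/-- THE PRINT's SECOND-ORDER COEFFICIENT `F′_{1,k}(ad_{A(b)})` IN THE LINEAGE: same data (`0 ≤ r`), diagonal block majorant
`diagK (2e(2r)·o + 2e(2r)³η)` (13b `fit_Phi2_ad`). [folklore] -/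
theorem hasMaj_idef_secondOrderCoeff (π : X' → X) (hbox : ∀ x, x ∈ box (blk x)) (hbox' : ∀ y, ∀ x' ∈ box' y, blk (π x') = y)
    {η₀ r η η' : ℝ} (hreg : η₀ * (2 * r) ≤ 1) (hr : 0 ≤ r) (hη' : 0 ≤ η') (hη'η : η' ≤ η) (hη : η ≤ η₀)
    {a' : X' → 𝔄} {a : X → 𝔄} (ha' : ∀ x', ‖a' x'‖ ≤ r) (ha : ∀ x, ‖a x‖ ≤ r)
    {o : g.Site → ℝ} (ho : ∀ y, 0 ≤ o y) (hfit : ∀ x', ‖a' x' - a (π x')‖ ≤ o (blk (π x'))) :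
    HasMaj (supSize g box blk : BlockNorm g (X → 𝔄)) (supSize g box' blk' : BlockNorm g (X' → 𝔄))
      (idef (pullV π) (pullV π) (emulOp fun x' => Phi2 η' (adCLM ℝ (a' x'))) (emulOp fun x => Phi2 η (adCLM ℝ (a x))))
      (diagK fun y => (2 * (Real.exp 1 * (2 * r))) * o y + 2 * (Real.exp 1 * (2 * r) ^ 3) * η) := by
  refine hasMaj_idef_emulOp π hbox hbox' (fun y => ?_) fun x' => ?_
  · have : 0 ≤ η := hη'.trans hη'η
    have := ho y
    positivity
  · exact fit_Phi2_ad π hreg hr hη' hη'η hη ha' ha (o := fun x => o (blk x)) hfit x'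

/-- THE RATE INSERTED (12c's `species1_rate` shape): with the (3.35)-SHAPED oscillation letter `o = d(M−1)·θ₁`, `θ₁ = η′G₁` (per-bond variation
of the fine background) and `Mη′ = η`, the transporter species' blockwise defect is `≤ (2e·d·G₁ + 2e(2r)²)·η`: ONE rate factor `η` times
`O(1)·`(gradient letter) + `O(1)·`(coefficient size)². [folklore] -/
theorem transporter_rate (d M : ℕ) {η η' G₁ r : ℝ} (hη' : 0 ≤ η') (hG₁ : 0 ≤ G₁) (hMη : (M : ℝ) * η' = η) :
    (2 * Real.exp 1) * ((d : ℝ) * ((M : ℝ) - 1) * (η' * G₁)) + 2 * (Real.exp 1 * (2 * r) ^ 2) * η ≤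
      (2 * Real.exp 1 * d * G₁ + 2 * (Real.exp 1 * (2 * r) ^ 2)) * η := by
  have h := T4EtaRateCoeffDefect.coeff_osc_rate d M hη' hG₁ rfl hMη
  have he : 0 ≤ 2 * Real.exp 1 := by positivity
  nlinarith [mul_le_mul_of_nonneg_left h he]

end EndToEnd

/-! ## §5 The linearised transport of a vector-valued background: the fibrewise mean and its fit -/

section BlockAvg

variable {X X' : Type} [Fintype X'] [DecidableEq X] {E : Type} [NormedAddCommGroup E] [NormedSpace ℝ E]

/-- THE BLOCK AVERAGE of an `E`-valued fine field over the fibres of `π` (`T4EtaRateCoeffDefect.blockAvg` for vector values: the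
linearisation of the transport (C3) of a `𝔤`-valued background; junk value `0` over an empty fibre). [folklore] -/
def blockAvgV (π : X' → X) (a' : X' → E) (x : X) : E := ((fibre π x).card : ℝ)⁻¹ • ∑ x' ∈ fibre π x, a' x'

/-- THE AVERAGED BACKGROUND FITS `A′` WITHIN THE OSCILLATION: from the vector oscillation letter `‖A′(x₁′) − A′(x₂′)‖ ≤ Ω(πx₁′)` on each fibre,
`‖A′(x′) − blockAvgV A′(πx′)‖ ≤ Ω(πx′)` (the average of the differences over the fibre; `T4EtaRateCoeffDefect.fit_blockAvg` in a normed space).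
On `ℤ^d` with cubes of side `M` the letter `Ω = d(M−1)θ₁` comes from the per-bond (3.35)-shaped bound `θ₁` inside blocks, componentwise by
`T4EtaRateCoeffDefect.osc_of_inBlockBondBound`. [folklore] -/
theorem fit_blockAvgV (π : X' → X) {a' : X' → E} {Ω : X → ℝ}
    (hosc : ∀ x₁' x₂', π x₁' = π x₂' → ‖a' x₁' - a' x₂'‖ ≤ Ω (π x₁')) (x' : X') :
    ‖a' x' - blockAvgV π a' (π x')‖ ≤ Ω (π x') := by
  set F : Finset X' := fibre π (π x') with hF
  have hx'F : x' ∈ F := (mem_fibre π (π x') x').2 rfl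
  have hcard : (0 : ℝ) < F.card := by exact_mod_cast Finset.card_pos.2 ⟨x', hx'F⟩
  have hrepr : a' x' - blockAvgV π a' (π x') = ((F.card : ℝ)⁻¹) • ∑ x'' ∈ F, (a' x' - a' x'') := by
    rw [blockAvgV, ← hF, Finset.sum_sub_distrib, Finset.sum_const, smul_sub, ← Nat.cast_smul_eq_nsmul ℝ, smul_smul,
      inv_mul_cancel₀ hcard.ne', one_smul]
  rw [hrepr, norm_smul, norm_inv, Real.norm_natCast, inv_mul_le_iff₀ hcard]
  calc ‖∑ x'' ∈ F, (a' x' - a' x'')‖ ≤ ∑ x'' ∈ F, ‖a' x' - a' x''‖ := norm_sum_le _ _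
    _ ≤ ∑ _x'' ∈ F, Ω (π x') :=
        Finset.sum_le_sum fun x'' hx'' => hosc x' x'' ((mem_fibre π (π x') x'').1 hx'').symm
    _ = F.card * Ω (π x') := by rw [Finset.sum_const, nsmul_eq_mul]

/-- The block average of a field of size `≤ r` has size `≤ r` over every NON-EMPTY fibre (the coarse background stays in the box of the
species letters; over an empty fibre the junk value `0` also does when `0 ≤ r`). [folklore] -/
theorem norm_blockAvgV_le (π : X' → X) {a' : X' → E} {r : ℝ} (hr : 0 ≤ r) (ha' : ∀ x', ‖a' x'‖ ≤ r) (x : X) :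
    ‖blockAvgV π a' x‖ ≤ r := by
  set F : Finset X' := fibre π x with hF
  by_cases h0 : F.card = 0
  · have hF0 : F = ∅ := Finset.card_eq_zero.1 h0
    rw [blockAvgV, ← hF, hF0]
    simpa using hr
  · have hcard : (0 : ℝ) < F.card := by exact_mod_cast Nat.pos_of_ne_zero h0
    rw [blockAvgV, ← hF, norm_smul, norm_inv, Real.norm_natCast, inv_mul_le_iff₀ hcard]
    calc ‖∑ x' ∈ F, a' x'‖ ≤ ∑ x' ∈ F, ‖a' x'‖ := norm_sum_le _ _
      _ ≤ ∑ _x' ∈ F, r := Finset.sum_le_sum fun x' _ => ha' x'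
      _ = F.card * r := by rw [Finset.sum_const, nsmul_eq_mul]

/-- §4 ∘ §5, THE TRANSPORTER WITH THE LINEARISED TRANSPORT: coarse background `Ā = blockAvgV π A′`; from `‖A′‖ ≤ r` (`0 ≤ r`), the regime
`η₀(2r) ≤ 1`, and the blockwise oscillation letter `‖A′(x₁′) − A′(x₂′)‖ ≤ Ω(blk(πx₁′))` on fibres, the transporter species' η-defect has the
diagonal block majorant `diagK (2e·Ω + 2e(2r)²η)`. [folklore] -/
theorem hasMaj_idef_transporter_blockAvgV {𝔄 : Type} [NormedRing 𝔄] [NormedAlgebra ℝ 𝔄] [CompleteSpace 𝔄]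
    {g : B6.Geometry} {box : g.Site → Finset X} {blk : X → g.Site} {box' : g.Site → Finset X'} {blk' : X' → g.Site}
    (π : X' → X) (hbox : ∀ x, x ∈ box (blk x)) (hbox' : ∀ y, ∀ x' ∈ box' y, blk (π x') = y)
    {η₀ r η η' : ℝ} (hreg : η₀ * (2 * r) ≤ 1) (hr : 0 ≤ r) (hη' : 0 ≤ η') (hη'η : η' ≤ η) (hη : η ≤ η₀)
    {a' : X' → 𝔄} (ha' : ∀ x', ‖a' x'‖ ≤ r) {Ω : g.Site → ℝ} (hΩ : ∀ y, 0 ≤ Ω y)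
    (hosc : ∀ x₁' x₂', π x₁' = π x₂' → ‖a' x₁' - a' x₂'‖ ≤ Ω (blk (π x₁'))) :
    HasMaj (supSize g box blk : BlockNorm g (X → 𝔄)) (supSize g box' blk' : BlockNorm g (X' → 𝔄))
      (idef (pullV π) (pullV π) (emulOp fun x' => Phi1 η' (adCLM ℝ (a' x')))
        (emulOp fun x => Phi1 η (adCLM ℝ (blockAvgV π a' x))))
      (diagK fun y => (2 * Real.exp 1) * Ω y + 2 * (Real.exp 1 * (2 * r) ^ 2) * η) :=
  hasMaj_idef_transporter π hbox hbox' hreg hη' hη'η hη ha' (norm_blockAvgV_le π hr ha') hΩ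
    (fit_blockAvgV π (Ω := fun x => Ω (blk x)) hosc)

end BlockAvg

end Summit.QuantumFields.YangMills.BalabanUVNodes.N15.MatrixSpecies
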